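/- Lead `ym-line-cbag-p1`, route `ColdBoxAllGroups`, crux `BoxFloorAllGroups` (stmt-QuantumFields-22254), line `birth`, stub S2, brick B9a
«CoreG»: the one-scale expansion assembled at fixed `β` (deterministic core), every compact group presented in `U(N)`. -/
import Summits.QuantumFields.YangMills.Theorems.ColdBoxAllGroupsBoxFloorAllGroupsGaussTailD
import Summits.QuantumFields.YangMills.Theorems.WeakCouplingRatesColdBoxDominationCore

/-!
# Crux `BoxFloorAllGroups`, stub S2, brick B9a «CoreG»: the one-scale expansion ASSEMBLED at fixed `β` — a deterministic bound on
# `|β²·boxPlaqCov ρ β H T − (D/4)·boxDirCircSqCov H T|`, given the representation (B4) and the large-field conditioning (B2) as hypotheses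

`G`-generic port of `WeakCouplingRatesColdBoxDominationCore.abs_boxPlaqCov_sub_dirCircSqCov_le_core` (there `SU(2)`, gnomonic chart, three
colours).  For a continuous faithful unitary `ρ : G →* U(N)`, `D = dimE ρ`, the cold-wall box of half-side `H ≥ 1`, `β ≥ 1`, `T ≤ H`,
small-field scale `ε`, link radius `0 ≤ m ≤ 1/4`, a chart density `g` (measurable, `|log g| ≤ ℓ` on `b(0,m)`), a Gaussian window
(`R ≥ 0`, `m_E = √D(12H²+2H+1)R/√β ≤ min(m, 1/4)`, `(D/2)R²/β + 190·m_E³ < β^{2ε−1}`), `240·D·(2H+1)⁴e^{−R²/2} ≤ p < 1`, and the two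
INPUTS of the sibling bricks as hypotheses —
* `hrep` (B4, RepresentationG): for every measurable gauge-invariant `X ≥ 0`,
  `∫ X d(boxState ρ β H[|coldGoodSetG]) = ∫ X∘cfgTE d(((gaussD H D)[|S]).tilted (𝟙_S·tiltWE ρ H g β))`,
  `S = goodTE ρ H β ε ∩ {t | ∀ e, ‖unscaleTE H D β t e‖ ≤ m}`;
* `hcond` (B2, GoodReductionG): `|boxPlaqCov ρ β H T − Cov_{boxState[|coldGoodSetG]}(c_{p_c}, c_{p_c+Te₀})| ≤ c₀` —
one has, with `M = β^{2ε}`, `τ = 190βm³`, `w = #Λ'·τ + #(ColdFreeIdx H)·ℓ`: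
**`abs_boxPlaqCov_sub_dirCircSqCov_le_coreG`**:
`|β²·boxPlaqCov ρ β H T − (D/4)·boxDirCircSqCov H T| ≤ β²c₀ + 3M²(e^{2w}−1) + 6M²p + 2τ(M+D) + √p·(2MD + 3D² + D²)`.
Chain: `hrep`, the covariance bookkeeping `abs_cov_tilted_cond_sub_cov_le` (tree, generic) fed by `abs_tiltWE_le` (TiltBoundG),
`beta_mul_plaqCostAt_mem_Icc_of_mem_goodTE` + `gaussD_real_compl_goodTE_inter_ball_le` (GaussTailD), `abs_qObsD_sub_beta_mul_plaqCostAt_le`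
(TiltBoundG), the moments `moments_qObsD_centre` and the colour identity `cov_qObsD_gaussD_eq` (GaussSideD).
No sorry; no new definition; standard axioms.  NOT a claim about the mass gap (rung-level support, RECORD label).
-/

set_option autoImplicit false

noncomputable section

open MeasureTheory ProbabilityTheory Finset Real
open Literature.Probability.LatticeModels (Site)
open Literature.MathematicalPhysics.QuantumLattice
open Literature.MathematicalPhysics.QuantumFieldTheory
open Literature.MathematicalPhysics.QuantumFieldTheory.LatticeMaxwell
open Literature.MathematicalPhysics.QuantumFieldTheory.AxialGauge
open Summit.QuantumFields.YangMills.Theorems.WeakCouplingRates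
open Summit.QuantumFields.YangMills.Theorems.FreeEnergyLogCoefficient

namespace Summit.QuantumFields.YangMills.Theorems.ColdBoxAllGroups

variable {N : ℕ} {G : Type*} [Group G] (ρ : G →* Matrix (Fin N) (Fin N) ℂ) {H : ℕ}

/-- `β·c_p` is gauge invariant (any group, any representation). -/
theorem isZdGaugeInvariant_const_mul_plaqCostAtG (β : ℝ) (x : Site 4) (i j : Fin 4) :
    IsZdGaugeInvariant (fun U : LGConfig 4 G => β * plaqCostAt ρ x i j U) :=
  fun g U => by simp only [plaqCostAt, isZdGaugeInvariant_plaquetteObs _ x i j g U]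

/-- `(β·c_p)(β·c_q)` is gauge invariant. -/
theorem isZdGaugeInvariant_const_mul_plaqCostAt_mulG (β : ℝ) (x y : Site 4) (i j k l : Fin 4) :
    IsZdGaugeInvariant (fun U : LGConfig 4 G => β * plaqCostAt ρ x i j U * (β * plaqCostAt ρ y k l U)) :=
  fun g U => by simp only [plaqCostAt, isZdGaugeInvariant_plaquetteObs _ x i j g U, isZdGaugeInvariant_plaquetteObs _ y k l g U]

/-- The ball condition on the chart coordinates is a measurable event. -/
theorem measurableSet_ball_unscaleTE (D : ℕ) (β m : ℝ) :
    MeasurableSet {t : TSpaceD H D | ∀ e, ‖unscaleTE H D β t e‖ ≤ m} := by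
  have h : {t : TSpaceD H D | ∀ e, ‖unscaleTE H D β t e‖ ≤ m} = ⋂ e, {t | ‖unscaleTE H D β t e‖ ≤ m} := by
    ext t; simp
  rw [h]
  exact MeasurableSet.iInter fun e =>
    measurableSet_le (((measurable_pi_apply e).comp (measurable_unscaleTE D β)).norm) measurable_const

variable [TopologicalSpace G] [IsTopologicalGroup G] [CompactSpace G] [MeasurableSpace G] [BorelSpace G] [SecondCountableTopology G]

set_option maxHeartbeats 400000 in
/-- **The one-scale expansion at fixed `β` (deterministic core), every compact group presented in `U(N)`.**  See the module docstring for
the hypotheses; the conclusion is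
`|β²·boxPlaqCov ρ β H T − (D/4)·boxDirCircSqCov H T| ≤ β²c₀ + 3M²(e^{2w}−1) + 6M²p + 2τ(M+D) + √p(2MD + 3D² + D²)`. -/
theorem abs_boxPlaqCov_sub_dirCircSqCov_le_coreG (hρ : Continuous ρ) (hinj : Function.Injective ρ)
    (hρu : ∀ g, ρ g ∈ Matrix.unitaryGroup (Fin N) ℂ) {β ε m ℓ R p c₀ : ℝ} {T : ℕ}
    {g : EuclideanSpace ℝ (Fin (dimE ρ)) → ℝ} (hgm : Measurable g)
    (hβ : 1 ≤ β) (hH : 1 ≤ H) (hT : T ≤ H) (hm0 : 0 ≤ m) (hm4 : m ≤ 1 / 4) (hℓ : 0 ≤ ℓ)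
    (hg : ∀ a, ‖a‖ ≤ m → |Real.log (g a)| ≤ ℓ) (hR : 0 ≤ R)
    (hmE : Real.sqrt (dimE ρ) * ((12 * (H : ℝ) ^ 2 + 2 * H + 1) * R) / Real.sqrt β ≤ 1 / 4)
    (hmEm : Real.sqrt (dimE ρ) * ((12 * (H : ℝ) ^ 2 + 2 * H + 1) * R) / Real.sqrt β ≤ m)
    (hwin : (dimE ρ : ℝ) / 2 * R ^ 2 / β + 190 * (Real.sqrt (dimE ρ) * ((12 * (H : ℝ) ^ 2 + 2 * H + 1) * R) / Real.sqrt β) ^ 3 <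
      β ^ (2 * ε - 1))
    (hp : 240 * (dimE ρ) * (2 * (H : ℝ) + 1) ^ 4 * Real.exp (-R ^ 2 / 2) ≤ p) (hp1 : p < 1)
    (hrep : ∀ X : LGConfig 4 G → ℝ, Measurable X → IsZdGaugeInvariant X → (∀ U, 0 ≤ X U) →
      ∫ U, X U ∂((boxState ρ β H)[|coldGoodSetG ρ H β ε]) =
        ∫ t, X (cfgTE ρ H β t) ∂(((gaussD H (dimE ρ))[|(goodTE ρ H β ε ∩ {t | ∀ e, ‖unscaleTE H (dimE ρ) β t e‖ ≤ m})]).tilted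
          ((goodTE ρ H β ε ∩ {t | ∀ e, ‖unscaleTE H (dimE ρ) β t e‖ ≤ m}).indicator (tiltWE ρ H g β))))
    (hcond : |boxPlaqCov ρ β H T -
        ((∫ U, plaqCostAt ρ (boxCentre H) 1 2 U * plaqCostAt ρ (boxCentre H + Pi.single 0 (T : ℤ)) 1 2 U
            ∂((boxState ρ β H)[|coldGoodSetG ρ H β ε])) -
          (∫ U, plaqCostAt ρ (boxCentre H) 1 2 U ∂((boxState ρ β H)[|coldGoodSetG ρ H β ε])) *
          (∫ U, plaqCostAt ρ (boxCentre H + Pi.single 0 (T : ℤ)) 1 2 U ∂((boxState ρ β H)[|coldGoodSetG ρ H β ε])))| ≤ c₀) :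
    |β ^ 2 * boxPlaqCov ρ β H T - (dimE ρ : ℝ) / 4 * boxDirCircSqCov H T| ≤
      β ^ 2 * c₀ + 3 * (β ^ (2 * ε)) ^ 2 * (Real.exp (2 * ((#(plaquettesTouching (boxEdges 4 (2 * H + 1))) : ℝ) * (190 * β * m ^ 3) +
          (Fintype.card (ColdFreeIdx H) : ℝ) * ℓ)) - 1) +
        6 * (β ^ (2 * ε)) ^ 2 * p + 2 * (190 * β * m ^ 3) * (β ^ (2 * ε) + dimE ρ) +
        Real.sqrt p * (2 * β ^ (2 * ε) * dimE ρ + 3 * (dimE ρ : ℝ) ^ 2 + (dimE ρ : ℝ) ^ 2) := by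
  have hβ0 : 0 < β := by linarith
  -- abbreviations
  set μ := boxState ρ β H with hμ
  set Gd := coldGoodSetG ρ H β ε with hGd
  set γ := gaussD H (dimE ρ) with hγ
  set S : Set (TSpaceD H (dimE ρ)) := goodTE ρ H β ε ∩ {t | ∀ e, ‖unscaleTE H (dimE ρ) β t e‖ ≤ m} with hS
  set x₁ : Site 4 := boxCentre H with hx₁
  set x₂ : Site 4 := boxCentre H + Pi.single 0 (T : ℤ) with hx₂
  set f : LGConfig 4 G → ℝ := fun U => β * plaqCostAt ρ x₁ 1 2 U with hf
  set g₂ : LGConfig 4 G → ℝ := fun U => β * plaqCostAt ρ x₂ 1 2 U with hg₂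
  set F : TSpaceD H (dimE ρ) → ℝ := fun t => β * plaqCostAt ρ x₁ 1 2 (cfgTE ρ H β t) with hF
  set Gt : TSpaceD H (dimE ρ) → ℝ := fun t => β * plaqCostAt ρ x₂ 1 2 (cfgTE ρ H β t) with hGt
  set Q₁ : TSpaceD H (dimE ρ) → ℝ := qObsD H (dimE ρ) (plaq12At x₁) with hQ₁
  set Q₂ : TSpaceD H (dimE ρ) → ℝ := qObsD H (dimE ρ) (plaq12At x₂) with hQ₂
  set τ : ℝ := 190 * β * m ^ 3 with hτ
  set w : ℝ := (#(plaquettesTouching (boxEdges 4 (2 * H + 1))) : ℝ) * τ + (Fintype.card (ColdFreeIdx H) : ℝ) * ℓ with hw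
  set M : ℝ := β ^ (2 * ε) with hM
  set ν := (γ[|S]).tilted (S.indicator (tiltWE ρ H g β)) with hν
  have hτ0 : 0 ≤ τ := by positivity
  have hM0 : 0 ≤ M := by positivity
  have hD0 : (0 : ℝ) ≤ (dimE ρ : ℝ) := Nat.cast_nonneg _
  have hSm : MeasurableSet S := (measurableSet_goodTE ρ hρ hinj β ε).inter (measurableSet_ball_unscaleTE (dimE ρ) β m)
  -- the Gaussian mass of the bad event, and `γ S ≠ 0`
  have hpS : γ.real Sᶜ ≤ p := (gaussD_real_compl_goodTE_inter_ball_le ρ hρ hβ0 hH hR hmE hmEm hwin).trans hp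
  have hS0 : γ S ≠ 0 := by
    intro h0
    have h1 : γ.real S = 0 := by rw [measureReal_def, h0, ENNReal.toReal_zero]
    have h2 : γ.real S + γ.real Sᶜ = 1 := by rw [measureReal_add_measureReal_compl hSm, probReal_univ]
    linarith
  -- step 1: the conditional covariance is the covariance under the tilted conditioned Gaussian
  have hmeas : ∀ (x : Site 4), Measurable fun U : LGConfig 4 G => β * plaqCostAt ρ x 1 2 U := fun x =>
    (measurable_plaqCostAt_of_continuous ρ hρ x 1 2).const_mul β
  have hnn : ∀ (x : Site 4) (U : LGConfig 4 G), 0 ≤ β * plaqCostAt ρ x 1 2 U := fun x U => by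
    refine mul_nonneg hβ0.le ?_
    simp only [plaqCostAt, plaquetteObs]
    rw [Literature.MathematicalPhysics.QuantumFieldTheory.sub_re_trace_eq_half_norm_sub_one_sq (hρu _)]
    positivity
  have hrepF : ∫ U, f U ∂(μ[|Gd]) = ∫ t, F t ∂ν := hrep _ (hmeas x₁) (isZdGaugeInvariant_const_mul_plaqCostAtG ρ β x₁ 1 2) (hnn x₁)
  have hrepG : ∫ U, g₂ U ∂(μ[|Gd]) = ∫ t, Gt t ∂ν := hrep _ (hmeas x₂) (isZdGaugeInvariant_const_mul_plaqCostAtG ρ β x₂ 1 2) (hnn x₂)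
  have hrepFG : ∫ U, f U * g₂ U ∂(μ[|Gd]) = ∫ t, F t * Gt t ∂ν :=
    hrep _ ((hmeas x₁).mul (hmeas x₂)) (isZdGaugeInvariant_const_mul_plaqCostAt_mulG ρ β x₁ x₂ 1 2 1 2)
      (fun U => mul_nonneg (hnn x₁ U) (hnn x₂ U))
  -- step 2: the bookkeeping
  have hPc := centre_mem_plaquettesTouching hH hT
  obtain ⟨⟨hQ₁L2, hQ₁K⟩, ⟨hQ₂L2, hQ₂K⟩, ⟨hQ₁₂L2, hQ₁₂K⟩⟩ := moments_qObsD_centre (H := H) (D := dimE ρ) hH hT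
  have hWb : ∀ t, |S.indicator (tiltWE ρ H g β) t| ≤ w := by
    intro t
    by_cases ht : t ∈ S
    · rw [Set.indicator_of_mem ht]
      have h := abs_tiltWE_le ρ hρ hβ0 hm0 hm4 hg t ht.2
      exact h
    · rw [Set.indicator_of_notMem ht, abs_zero, hw]; positivity
  have hFb : ∀ t ∈ S, 0 ≤ F t ∧ F t ≤ M := fun t ht => by
    have h := beta_mul_plaqCostAt_mem_Icc_of_mem_goodTE ρ hρu hβ ht.1 hPc.1
    exact h
  have hGb : ∀ t ∈ S, 0 ≤ Gt t ∧ Gt t ≤ M := fun t ht => by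
    have h := beta_mul_plaqCostAt_mem_Icc_of_mem_goodTE ρ hρu hβ ht.1 hPc.2
    exact h
  have hFQ : ∀ t ∈ S, |F t - Q₁ t| ≤ τ := fun t ht => by
    have h := abs_qObsD_sub_beta_mul_plaqCostAt_le ρ hρ hβ0 hm0 hm4 t ht.2 x₁ 1 2
    rw [abs_sub_comm] at h
    exact h
  have hGQ : ∀ t ∈ S, |Gt t - Q₂ t| ≤ τ := fun t ht => by
    have h := abs_qObsD_sub_beta_mul_plaqCostAt_le ρ hρ hβ0 hm0 hm4 t ht.2 x₂ 1 2
    rw [abs_sub_comm] at h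
    exact h
  have hK'sq : ∫ t, (Q₁ t * Q₂ t) ^ 2 ∂γ ≤ (3 * (dimE ρ : ℝ) ^ 2) ^ 2 := hQ₁₂K.trans (by nlinarith [pow_nonneg hD0 4])
  have hbook := abs_cov_tilted_cond_sub_cov_le (γ := γ) hSm hS0 (measurable_tiltWE ρ hρ hinj hgm β) hWb
    ((hmeas x₁).comp (measurable_cfgTE ρ hρ hinj β)) ((hmeas x₂).comp (measurable_cfgTE ρ hρ hinj β))
    hQ₁L2 hQ₂L2 hQ₁₂L2 hM0 hτ0 hD0 (by positivity : (0 : ℝ) ≤ 3 * (dimE ρ : ℝ) ^ 2) hFb hGb hFQ hGQ hpS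
    (hQ₁K.trans (le_of_eq (by ring))) (hQ₂K.trans (le_of_eq (by ring))) hK'sq
  -- step 3: the colour identity
  have hcol : (∫ t, Q₁ t * Q₂ t ∂γ) - (∫ t, Q₁ t ∂γ) * (∫ t, Q₂ t ∂γ) = (dimE ρ : ℝ) / 4 * boxDirCircSqCov H T := cov_qObsD_gaussD_eq hH hT
  -- assemble
  have hcov : β ^ 2 * boxPlaqCov ρ β H T - (dimE ρ : ℝ) / 4 * boxDirCircSqCov H T =
      β ^ 2 * (boxPlaqCov ρ β H T -
        ((∫ U, plaqCostAt ρ x₁ 1 2 U * plaqCostAt ρ x₂ 1 2 U ∂(μ[|Gd])) -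
          (∫ U, plaqCostAt ρ x₁ 1 2 U ∂(μ[|Gd])) * (∫ U, plaqCostAt ρ x₂ 1 2 U ∂(μ[|Gd])))) +
      ((((∫ t, F t * Gt t ∂ν) - (∫ t, F t ∂ν) * (∫ t, Gt t ∂ν)) -
          ((∫ t, Q₁ t * Q₂ t ∂γ) - (∫ t, Q₁ t ∂γ) * (∫ t, Q₂ t ∂γ)))) := by
    rw [hcol, ← hrepF, ← hrepG, ← hrepFG, ← sq_mul_cov_eq]
    ring
  have h1 : |β ^ 2 * (boxPlaqCov ρ β H T -
        ((∫ U, plaqCostAt ρ x₁ 1 2 U * plaqCostAt ρ x₂ 1 2 U ∂(μ[|Gd])) -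
          (∫ U, plaqCostAt ρ x₁ 1 2 U ∂(μ[|Gd])) * (∫ U, plaqCostAt ρ x₂ 1 2 U ∂(μ[|Gd]))))| ≤ β ^ 2 * c₀ := by
    rw [abs_mul, abs_of_nonneg (by positivity : (0 : ℝ) ≤ β ^ 2)]
    exact mul_le_mul_of_nonneg_left hcond (by positivity)
  rw [hcov]
  refine (abs_add_le _ _).trans ((add_le_add h1 hbook).trans (le_of_eq ?_))
  ring

end Summit.QuantumFields.YangMills.Theorems.ColdBoxAllGroups

end
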